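import Mathlib
import Summits.AtomisticToContinuum.Crystallization.Theorems.ChessboardParticlePlanesLjLaminarWindowsMinDistDefs
import Summits.AtomisticToContinuum.Crystallization.Theorems.ChessboardParticlePlanesLjLaminarWindowsForceBalance
import Summits.AtomisticToContinuum.Crystallization.Theorems.ChessboardParticlePlanesLjLaminarWindowsForceTheta
import Summits.AtomisticToContinuum.Crystallization.Theorems.ChessboardParticlePlanesLjLaminarWindowsForceClubsuit
import Summits.AtomisticToContinuum.Crystallization.Theorems.ChessboardParticlePlanesLjLaminarWindowsForceCapacity
import Literature.MathematicalPhysics.StatisticalMechanics.Yuhjtman2015Proofs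
import HarnessLib

/-!
# Every Lennard-Jones ground state is `7/10`-separated (stub `stub_minDistance07` of line `Sketch`, crux `LjLaminarWindows`, stmt-AtomisticToContinuum-6711)

THE RESULT of the minimal-distance programme of line `Sketch` (lead
prover-line-stmt-AtomisticToContinuum-6711-c1-0, 2026-08-16): for the Lennard-Jones potential
`V_LJ(r) = r⁻¹²/12 - r⁻⁶/6` (equilibrium distance `1`), every ground state of `N` particles in `ℝ³`
has all interparticle distances `≥ 7/10`.  This sharpens Yuhjtman's published bound `0.684`
(`Yuhjtman2015_minDistance_holds`, J. Stat. Phys. 160 (2015), Cor. 7) and is, as far as we know,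
not in print; the gain comes from ONE new ingredient, the FORCE-BALANCE identity at the closest
pair (`stub_forceBalance`, file `…ForceBalance.lean`): a ground state is a critical point of the
energy in each particle position, so at the particle `p` of a closest pair `(p, q)` (distance `a`)
`∑_{k ≠ p, q} (h(r_{pk}) + t|h'(r_{pk})|) ≥ 1 - h(a) + t h'(a)` for every `t ≥ 0`
(`h = 2r⁻⁶ - r⁻¹² = -12 V_LJ`, `h' = 12r⁻¹³ - 12r⁻⁷`); with `t = 1/25` the right-hand side is
`99.96` at `a = 0.7` (instead of `56.25` without the force term), while the left-hand side — the
"charged" minus-energy `kF = h + |h'|/25` summed over an `a`-separated family — still admits a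
Yuhjtman-type capacity bound `≤ 24·(28/25)/a³ = 78.4` (`stub_forceCapacity`, from the convex
majorant `thetaF`/`gamF` of `…MinDistDefs.lean`, its one-variable facts `stub_forceTheta` and the
near-cut-off inequality `stub_forceClubsuit`), contradicting the final inequality
`stub_forceFinalIneq` for every `a ∈ [0.684, 0.7]`.

All five ingredients are landed theorems of namespace `…Theorems.LjLaminarWindowsSketch`; this file
only assembles them (closest pair, `c = a/2`, Yuhjtman's `a > 0.684`).  The statement is the
registered stub `stub_minDistance07` of the crux's skeleton (rev. 4/6); the skeleton's
`sepDensity_of_minDistance07` turns it into the separation-density input of the composition.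
-/

noncomputable section

open scoped BigOperators
open Literature.MathematicalPhysics.StatisticalMechanics
open Literature.MathematicalPhysics.StatisticalMechanics.Yuhjtman2015

namespace Summit.AtomisticToContinuum.Crystallization.Theorems.LjLaminarWindowsSketch

/-- **Every Lennard-Jones ground state in `ℝ³` is `7/10`-separated** (registered stub
`stub_minDistance07` of line `Sketch`, crux `LjLaminarWindows`; NEW — sharpens Yuhjtman 2015,
Cor. 7 (`0.684`) by the force-balance identity at the closest pair).  Proof: at a closest pair
`(p, q)` with `a = dist ≤ 7/10` (and `a > 0.684` by `Yuhjtman2015_minDistance_holds`), force balance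
with `t = 1/25` (`stub_forceBalance`) gives `1 - h(a) + h'(a)/25 ≤ ∑_{k ≠ p,q} kF(‖x_k - x_p‖)`; the
capacity bound (`stub_forceCapacity stub_forceTheta stub_forceClubsuit`) with `c = a/2` bounds the
right-hand side by `(84/25)/c³ = 24·(28/25)/a³`; the final inequality (`stub_forceFinalIneq`) says
this is `< 1 - h(a) + h'(a)/25` — contradiction. [folklore] -/
theorem stub_minDistance07 :
    ∀ (N : ℕ) (x : Fin N → EuclideanSpace ℝ (Fin 3)), IsGroundState lennardJones x →
      ∀ j k : Fin N, j ≠ k → (7 : ℝ) / 10 ≤ dist (x j) (x k) := by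
  intro N x hx j k hjk
  by_contra hlt
  rw [not_le] at hlt
  -- a closest pair `(p, q)`
  obtain ⟨pr, hpr, hmin⟩ := Finset.exists_min_image Finset.univ.offDiag
    (fun pr : Fin N × Fin N ↦ dist (x pr.1) (x pr.2)) ⟨(j, k), by simp [hjk]⟩
  obtain ⟨p, q⟩ := pr
  have hpq : p ≠ q := by simpa using hpr
  set a := dist (x p) (x q) with ha_def
  have hsep : ∀ k l, k ≠ l → a ≤ dist (x k) (x l) := fun k l hkl ↦ hmin (k, l) (by simp [hkl])
  have ha7 : a ≤ 7 / 10 := (hsep j k hjk).trans hlt.le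
  have ha684 : 171 / 250 ≤ a := by
    have h := Yuhjtman2015_minDistance_holds N x hx p q hpq
    norm_num at h
    exact h.le
  have ha0 : 0 < a := by linarith
  -- force balance with `t = 1/25`
  have h1 := stub_forceBalance N x hx p q hpq (1 / 25) (by norm_num)
  -- capacity with `c = a/2` for the points `x k - x p`, `k ≠ p, q`
  have h2 := stub_forceCapacity stub_forceTheta stub_forceClubsuit N ((Finset.univ.erase p).erase q)
    (fun k => x k - x p) (a / 2) (by linarith) (by linarith)
    (fun i hi => by
      have hip : i ≠ p := Finset.ne_of_mem_erase (Finset.mem_of_mem_erase hi)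
      have h := hsep i p hip
      rw [dist_eq_norm] at h
      linarith)
    (fun i _ j _ hij => by
      rw [dist_eq_norm, show x i - x p - (x j - x p) = x i - x j by abel, ← dist_eq_norm]
      linarith [hsep i j hij])
  have h2' : ∑ k ∈ (Finset.univ.erase p).erase q, (hLJ (dist (x p) (x k)) +
      1 / 25 * |12 * (dist (x p) (x k))⁻¹ ^ 13 - 12 * (dist (x p) (x k))⁻¹ ^ 7|) ≤
        84 / 25 / (a / 2) ^ 3 := by
    refine le_of_eq_of_le (Finset.sum_congr rfl fun k _ ↦ ?_) h2
    rw [dist_comm, dist_eq_norm]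
    rfl
  -- the final inequality
  have h3 : 24 * (28 / 25) / a ^ 3 <
      1 - hLJ a + 1 / 25 * (12 * a⁻¹ ^ 13 - 12 * a⁻¹ ^ 7) := stub_forceFinalIneq a ha684 ha7
  have e : 84 / 25 / (a / 2) ^ 3 = 24 * (28 / 25) / a ^ 3 := by
    field_simp
    ring
  rw [e] at h2'
  linarith

/-- **Corollary in Yuhjtman's format**: every Lennard-Jones ground state of `N` particles in `ℝ³`
has all interparticle distances `> 0.69` (indeed `≥ 0.7`, `stub_minDistance07`); compare
`Yuhjtman2015_minDistance` (`> 0.684`). [folklore] -/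
theorem lennardJones_groundState_dist_ge_seven_tenths {N : ℕ}
    {x : Fin N → EuclideanSpace ℝ (Fin 3)} (hx : IsGroundState lennardJones x) {i j : Fin N}
    (hij : i ≠ j) : (7 : ℝ) / 10 ≤ dist (x i) (x j) :=
  stub_minDistance07 N x hx i j hij

end Summit.AtomisticToContinuum.Crystallization.Theorems.LjLaminarWindowsSketch

end
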